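import Literature.NumberTheory.EllipticCurves.PAdicHeightsRegulatorProofs
import Literature.NumberTheory.EllipticCurves.MordellWeilTheoremProofs

/-!
# BirchSwinnertonDyer / PAdicOrderV2 — crux `PAdicOrderThesisR2` (stmt-0487), line
# `lambda-adic-gz-square-class`, stub `stub_rank_regulator_of_nonSquarePair` (G, glue)

Registered stub (G) of the lead skeleton (`Cruxes/PAdicOrderThesisR2/Lines/
lambda_adic_gz_square_class.lean`). For an elliptic curve `E/ℚ` (Weierstrass model `W`), a prime
`p` and ANY `p`-adic height datum `D` (a symmetric biadditive pairing
`⟨·,·⟩_D : E(ℚ) × E(ℚ) → ℚ_p` vanishing on torsion, `WeierstrassCurve.PAdicHeightData`): if there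
are two rational points `P`, `Q` with `⟨P,P⟩_D ≠ 0`, `⟨Q,Q⟩_D ≠ 0` and `⟨P,P⟩_D / ⟨Q,Q⟩_D` NOT a
square in `ℚ_p`, then

* `2 ≤ rank_ℤ E(ℚ)`, and
* if `rank_ℤ E(ℚ) = 2` then `Reg_p(E, D) ≠ 0` (`WeierstrassCurve.SchneiderConjecture D`).

This is pure linear algebra over `ℚ_p` (the Gram determinant of a binary quadratic form), on top
of the Mordell–Weil theorem (existence of a Mordell–Weil basis,
`WeierstrassCurve.exists_isMordellWeilBasis_holds`, PROVED in the tree) and the basis independence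
of the `p`-adic regulator (`WeierstrassCurve.IsMordellWeilBasis.padicRegulatorOf_eq_padicRegulator`,
PROVED; Mazur–Tate–Teitelbaum 1986, §II.4: the `p`-adic regulator is the discriminant of the
height pairing on `E(ℚ)/tors`).

Proof. Both conclusions follow from ONE observation: the non-square ratio excludes the Gram
relation `⟨P,P⟩ ⟨Q,Q⟩ = ⟨P,Q⟩²` (else `⟨P,P⟩/⟨Q,Q⟩ = (⟨P,Q⟩/⟨Q,Q⟩)²`,
`isSquare_div_of_mul_eq_mul_self`). Take a Mordell–Weil basis `B : Fin r → E(ℚ)`,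
`r = rank_ℤ E(ℚ)`; every point is `R ≡ ∑ cᵢ Bᵢ (mod torsion)` with `cᵢ ∈ ℤ`
(`exists_isOfFinAddOrder_sub_sum`), so by biadditivity and torsion-vanishing
`⟨R, R'⟩_D = ∑ᵢ ∑ⱼ cᵢ c'ⱼ ⟨Bᵢ, Bⱼ⟩_D` (`pairing_eq_sum_sum`, the coordinate expansion).

* If `r ≤ 1` the Gram relation holds identically (`r = 0`: all values vanish; `r = 1`:
  `⟨R,R'⟩ = c c' d` with `d = ⟨B₀,B₀⟩`; `gram_eq_of_rank_le_one`) — contradiction, so `2 ≤ r`.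
* If `r = 2`, Lagrange's identity for the binary quadratic form `q = (a, b, c)`,
  `a = ⟨B₀,B₀⟩`, `b = ⟨B₀,B₁⟩`, `c = ⟨B₁,B₁⟩`, reads
  `⟨R,R⟩⟨R',R'⟩ - ⟨R,R'⟩² = (ac - b²) · (x y' - y x')²` (`gram_sub_eq_det_mul_sq`), and
  `ac - b² = det (⟨Bᵢ,Bⱼ⟩) = Reg_p(E, D)` (basis independence + `Matrix.det_fin_two`); so
  `Reg_p = 0` would force the Gram relation — contradiction.

Instances. As in `PAdicHeightsRegulatorProofs.lean`: the group law on `E(ℚ) = W.toAffine.Point`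
is elaborated against `instDecidableEqRat` in `ℚ`-files (the type of `D.pairing`) but against the
classical `DecidableEq` instance inside the generic-field notion `IsMordellWeilBasis`
(`MordellWeil.lean`); the coordinate lemma is proved over a general field and its output is
transported once by `convert` (`exists_coords`), the two instances being equal
(`DecidableEq ℚ` is a subsingleton). Proofs only, no new `def`.

References: B. Mazur, J. Tate, J. Teitelbaum, *On `p`-adic analogues of the conjectures of Birch
and Swinnerton-Dyer*, Invent. Math. 84 (1986) 1–48, §II.4 (`p`-adic height and regulator);
P. Schneider, *`p`-adic height pairings I*, Invent. Math. 69 (1982) 401–409, §1 (non-degeneracy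
conjecture).
-/

-- single-conjunct summit: `Summit.BirchSwinnertonDyer.BirchSwinnertonDyer.…` repeats the name by design
set_option linter.dupNamespace false

noncomputable section

open scoped Classical

namespace Summit.BirchSwinnertonDyer.BirchSwinnertonDyer.Cruxes.PAdicOrderThesisR2.LambdaAdicGZ

open Literature.NumberTheory.EllipticCurves

/-! ### Square classes -/

/-- In a field, the Gram relation `u v = w²` with `v ≠ 0` puts `u` and `v` in the same square
class: `u / v = (w / v)²`. [folklore] -/
theorem isSquare_div_of_mul_eq_mul_self {F : Type*} [Field F] {u v w : F} (h : u * v = w * w)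
    (hv : v ≠ 0) : IsSquare (u / v) :=
  ⟨w / v, by rw [div_mul_div_comm, ← h, mul_div_mul_right _ _ hv]⟩

/-! ### Coordinates modulo torsion on a Mordell–Weil basis (any field) -/

section AnyField

variable {K : Type*} [Field K] {W : WeierstrassCurve K}

/-- **Coordinates on a Mordell–Weil basis.** If `B : ι → E(K)` (`ι` finite) is a Mordell–Weil
basis (its classes form a `ℤ`-basis of `E(K)/E(K)_tors`), every point `R ∈ E(K)` is
`R = ∑ cᵢ Bᵢ + T` with `cᵢ ∈ ℤ` and `T` torsion (Silverman AEC VIII.6; here only the spanning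
half of the basis property is used, via Mathlib `Submodule.mem_span_range_iff_exists_fun`).
[cite: SilvermanAEC2009, VIII.6] -/
theorem exists_isOfFinAddOrder_sub_sum {ι : Type*} [Fintype ι] {B : ι → W.toAffine.Point}
    (hB : WeierstrassCurve.IsMordellWeilBasis B) (R : W.toAffine.Point) :
    ∃ c : ι → ℤ, IsOfFinAddOrder (R - ∑ i, c i • B i) := by
  have hmem : (QuotientAddGroup.mk R : WeierstrassCurve.mordellWeilModTorsion W) ∈
      Submodule.span ℤ (Set.range
        (QuotientAddGroup.mk ∘ B : ι → WeierstrassCurve.mordellWeilModTorsion W)) := by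
    rw [hB.2]
    exact Submodule.mem_top
  obtain ⟨c, hc⟩ := (Submodule.mem_span_range_iff_exists_fun ℤ).1 hmem
  refine ⟨c, ?_⟩
  rw [← AddCommGroup.mem_torsion, ← QuotientAddGroup.eq_iff_sub_mem, ← hc,
    QuotientAddGroup.mk_sum]
  simp only [Function.comp_apply, QuotientAddGroup.mk_zsmul]

end AnyField

/-! ### The coordinate expansion of a `p`-adic height pairing over `ℚ` -/

section Rat

variable {W : WeierstrassCurve ℚ} {p : ℕ} [Fact p.Prime]

/-- Coordinates on a Mordell–Weil basis of `E(ℚ)`: every `R ∈ E(ℚ)` is `∑ cᵢ Bᵢ` plus a torsion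
point (`exists_isOfFinAddOrder_sub_sum`, restated with the group law of `E(ℚ)` computed with the
decidable equality of `ℚ`, as in the type of a `p`-adic height datum; the two `DecidableEq ℚ`
instances agree). [cite: SilvermanAEC2009, VIII.6] -/
theorem exists_coords {ι : Type*} [Fintype ι] {B : ι → W.toAffine.Point}
    (hB : WeierstrassCurve.IsMordellWeilBasis B) (R : W.toAffine.Point) :
    ∃ c : ι → ℤ, IsOfFinAddOrder (R - ∑ i, c i • B i) := by
  obtain ⟨c, hc⟩ := exists_isOfFinAddOrder_sub_sum hB R
  exact ⟨c, by convert hc⟩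

/-- **Expansion in the second variable.** For a `p`-adic height datum `D` (biadditive, vanishing
on torsion) and `R ≡ ∑ cᵢ Bᵢ (mod torsion)`: `⟨Q, R⟩_D = ∑ᵢ cᵢ ⟨Q, Bᵢ⟩_D`
(Mazur–Tate–Teitelbaum 1986, §II.4: the height pairing is a pairing on `E(ℚ)/tors`).
[cite: MazurTateTeitelbaum1986Invent, §II.4] -/
theorem pairing_right_eq_sum (D : WeierstrassCurve.PAdicHeightData W p) {ι : Type*} [Fintype ι]
    (B : ι → W.toAffine.Point) {R : W.toAffine.Point} {c : ι → ℤ}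
    (hc : IsOfFinAddOrder (R - ∑ i, c i • B i)) (Q : W.toAffine.Point) :
    D.pairing Q R = ∑ i, (c i : ℚ_[p]) * D.pairing Q (B i) := by
  have hR : R = (R - ∑ i, c i • B i) + ∑ i, c i • B i := (sub_add_cancel R _).symm
  rw [hR, map_add, D.map_torsion_right Q _ hc, zero_add, map_sum]
  exact Finset.sum_congr rfl fun i _ => by rw [map_zsmul, zsmul_eq_mul]

/-- **Expansion in the first variable** (from `pairing_right_eq_sum` and the symmetry of `D`):
for `R ≡ ∑ cᵢ Bᵢ (mod torsion)`, `⟨R, Q⟩_D = ∑ᵢ cᵢ ⟨Bᵢ, Q⟩_D`.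
[cite: MazurTateTeitelbaum1986Invent, §II.4] -/
theorem pairing_left_eq_sum (D : WeierstrassCurve.PAdicHeightData W p) {ι : Type*} [Fintype ι]
    (B : ι → W.toAffine.Point) {R : W.toAffine.Point} {c : ι → ℤ}
    (hc : IsOfFinAddOrder (R - ∑ i, c i • B i)) (Q : W.toAffine.Point) :
    D.pairing R Q = ∑ i, (c i : ℚ_[p]) * D.pairing (B i) Q := by
  rw [D.symm R Q, pairing_right_eq_sum D B hc Q]
  exact Finset.sum_congr rfl fun i _ => by rw [D.symm]

/-- **The coordinate expansion of a `p`-adic height pairing.** For a `p`-adic height datum `D`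
on `E(ℚ)`, a family `B : ι → E(ℚ)` and points `R ≡ ∑ cᵢ Bᵢ`, `R' ≡ ∑ c'ⱼ Bⱼ (mod torsion)`:
`⟨R, R'⟩_D = ∑ᵢ ∑ⱼ cᵢ c'ⱼ ⟨Bᵢ, Bⱼ⟩_D`, i.e. `⟨R, R'⟩_D = cᵀ G c'` with `G` the Gram matrix of
`D` on `B` (Mazur–Tate–Teitelbaum 1986, §II.4). [cite: MazurTateTeitelbaum1986Invent, §II.4] -/
theorem pairing_eq_sum_sum (D : WeierstrassCurve.PAdicHeightData W p) {ι : Type*} [Fintype ι]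
    (B : ι → W.toAffine.Point) {R R' : W.toAffine.Point} {c c' : ι → ℤ}
    (hc : IsOfFinAddOrder (R - ∑ i, c i • B i)) (hc' : IsOfFinAddOrder (R' - ∑ i, c' i • B i)) :
    D.pairing R R' = ∑ i, ∑ j, (c i : ℚ_[p]) * (c' j : ℚ_[p]) * D.pairing (B i) (B j) := by
  rw [pairing_left_eq_sum D B hc R']
  refine Finset.sum_congr rfl fun i _ => ?_
  rw [pairing_right_eq_sum D B hc' (B i), Finset.mul_sum]
  exact Finset.sum_congr rfl fun j _ => by ring

/-- **Rank `≤ 1`: all values of the pairing satisfy the Gram relation.** If `E(ℚ)` has a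
Mordell–Weil basis indexed by `Fin r` with `r ≤ 1`, then `⟨R,R⟩_D ⟨R',R'⟩_D = ⟨R,R'⟩_D²` for all
`R, R'` (`r = 0`: every value is `0`; `r = 1`: `⟨R,R'⟩_D = c c' ⟨B₀,B₀⟩_D`). [folklore] -/
theorem gram_eq_of_rank_le_one (D : WeierstrassCurve.PAdicHeightData W p) {r : ℕ} (hr : r ≤ 1)
    {B : Fin r → W.toAffine.Point} (hB : WeierstrassCurve.IsMordellWeilBasis B)
    (R R' : W.toAffine.Point) :
    D.pairing R R * D.pairing R' R' = D.pairing R R' * D.pairing R R' := by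
  obtain ⟨c, hc⟩ := exists_coords hB R
  obtain ⟨c', hc'⟩ := exists_coords hB R'
  rw [pairing_eq_sum_sum D B hc hc, pairing_eq_sum_sum D B hc' hc', pairing_eq_sum_sum D B hc hc']
  rcases Nat.le_one_iff_eq_zero_or_eq_one.mp hr with rfl | rfl
  · simp
  · simp only [Fin.sum_univ_one]
    ring

/-- **Rank `2`: Lagrange's identity.** On a Mordell–Weil basis `B₀, B₁` of `E(ℚ)` write
`a = ⟨B₀,B₀⟩_D`, `b = ⟨B₀,B₁⟩_D = ⟨B₁,B₀⟩_D`, `c = ⟨B₁,B₁⟩_D` and `R ≡ x B₀ + y B₁`,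
`R' ≡ x' B₀ + y' B₁ (mod torsion)`; then
`⟨R,R⟩_D ⟨R',R'⟩_D - ⟨R,R'⟩_D² = (a c - b²) (x y' - y x')²`, and `a c - b² = det (⟨Bᵢ,Bⱼ⟩_D)`
(`Matrix.det_fin_two`): the Gram determinant of `R, R'` is the Gram determinant of the basis times
the square of the determinant of the coordinates. [folklore] -/
theorem gram_sub_eq_det_mul_sq (D : WeierstrassCurve.PAdicHeightData W p)
    {B : Fin 2 → W.toAffine.Point} (hB : WeierstrassCurve.IsMordellWeilBasis B)
    (R R' : W.toAffine.Point) :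
    ∃ t : ℚ_[p], D.pairing R R * D.pairing R' R' - D.pairing R R' * D.pairing R R' =
      (D.pairingMatrix B).det * t ^ 2 := by
  obtain ⟨c, hc⟩ := exists_coords hB R
  obtain ⟨c', hc'⟩ := exists_coords hB R'
  refine ⟨(c 0 : ℚ_[p]) * c' 1 - c 1 * c' 0, ?_⟩
  rw [pairing_eq_sum_sum D B hc hc, pairing_eq_sum_sum D B hc' hc', pairing_eq_sum_sum D B hc hc',
    Matrix.det_fin_two]
  simp only [Fin.sum_univ_two, WeierstrassCurve.PAdicHeightData.pairingMatrix, Matrix.of_apply]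
  rw [D.symm (B 1) (B 0)]
  ring

end Rat

/-! ### The stub -/

/-- **Stub `stub_rank_regulator_of_nonSquarePair` (G) of line `lambda-adic-gz-square-class`
(crux `PAdicOrderThesisR2`, stmt-0487).** For any symmetric biadditive torsion-vanishing pairing
`D` on `E(ℚ)` with values in `ℚ_p` (`WeierstrassCurve.PAdicHeightData`), two points `P`, `Q` with
non-zero self-pairings of NON-SQUARE ratio force `2 ≤ rank_ℤ E(ℚ)`, and if `rank_ℤ E(ℚ) = 2`
then `Reg_p(E, D) ≠ 0` (`WeierstrassCurve.SchneiderConjecture D`). Proof: the non-square ratio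
excludes the Gram relation `⟨P,P⟩⟨Q,Q⟩ = ⟨P,Q⟩²` (`isSquare_div_of_mul_eq_mul_self`); on a
Mordell–Weil basis `B : Fin r → E(ℚ)` (`WeierstrassCurve.exists_isMordellWeilBasis_holds`) that
relation holds identically if `r ≤ 1` (`gram_eq_of_rank_le_one`), and if `r = 2` it is
equivalent to `Reg_p(E, D) = 0` up to the square `(x y' - y x')²` (Lagrange's identity
`gram_sub_eq_det_mul_sq`; `Reg_p(E, D) = det (⟨Bᵢ,Bⱼ⟩_D)` by basis independence,
`WeierstrassCurve.IsMordellWeilBasis.padicRegulatorOf_eq_padicRegulator`, Mazur–Tate–Teitelbaum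
1986, §II.4). [cite: MazurTateTeitelbaum1986Invent, §II.4] -/
theorem stub_rank_regulator_of_nonSquarePair :
    ∀ (W : WeierstrassCurve ℚ) [W.IsElliptic] (p : ℕ) [Fact p.Prime]
      (D : WeierstrassCurve.PAdicHeightData W p),
      (∃ P Q : W.toAffine.Point, D.pairing P P ≠ 0 ∧ D.pairing Q Q ≠ 0 ∧
        ¬ IsSquare (D.pairing P P / D.pairing Q Q)) →
      2 ≤ W.mordellWeilRank ∧ (W.mordellWeilRank = 2 → WeierstrassCurve.SchneiderConjecture D) := by
  rintro W _ p _ D ⟨P, Q, -, hQ, hsq⟩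
  -- the non-square ratio excludes the Gram relation `⟨P,P⟩⟨Q,Q⟩ = ⟨P,Q⟩²`
  have key : D.pairing P P * D.pairing Q Q ≠ D.pairing P Q * D.pairing P Q := fun h =>
    hsq (isSquare_div_of_mul_eq_mul_self h hQ)
  -- a Mordell–Weil basis `B : Fin r → E(ℚ)`, `r = rank_ℤ E(ℚ)` (Mordell–Weil, proved in the tree)
  obtain ⟨B, hB⟩ := W.exists_isMordellWeilBasis_holds
  refine ⟨?_, fun h2 => ?_⟩
  · -- `r ≤ 1` would force the Gram relation
    by_contra hlt
    exact key (gram_eq_of_rank_le_one D (by omega) hB P Q)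
  · -- `r = 2`: `Reg_p(E, D) = det (⟨Bᵢ,Bⱼ⟩_D)` on the basis reindexed by `Fin 2`, and
    -- `Reg_p = 0` would force the Gram relation by Lagrange's identity
    unfold WeierstrassCurve.SchneiderConjecture
    intro hreg
    have hB₂ := hB.reindex (finCongr h2)
    obtain ⟨t, ht⟩ := gram_sub_eq_det_mul_sq D hB₂ P Q
    have h0 : WeierstrassCurve.padicRegulatorOf D (B ∘ (finCongr h2).symm) = 0 :=
      (hB₂.padicRegulatorOf_eq_padicRegulator D).trans hreg
    have hdet : (D.pairingMatrix (B ∘ (finCongr h2).symm)).det = 0 := by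
      unfold WeierstrassCurve.padicRegulatorOf at h0
      -- (`convert`: the `DecidableEq (Fin 2)` instance inside `padicRegulatorOf` is the classical one)
      convert h0 using 2
    rw [hdet, zero_mul, sub_eq_zero] at ht
    exact key ht

end Summit.BirchSwinnertonDyer.BirchSwinnertonDyer.Cruxes.PAdicOrderThesisR2.LambdaAdicGZ

end
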